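import Mathlib
import Summits.ResolutionOfSingularities.ResolutionOfSingularities.Theorems.WeightedInvariantLocalWeightedDropTOT2CurveConflictBirthCurveOneExample
import Summits.ResolutionOfSingularities.ResolutionOfSingularities.Theorems.WeightedInvariantLocalWeightedDropTOT2CurveConflictBirthPointExample

/-!
# `LocalWeightedDrop`, TOT2-LINE regime (P), piece (P3) — regression test #3: BOTH LABELS ARE REGIME LABELS (`InPoly`)

Crux item stmt-ResolutionOfSingularities-8899 `WeightedInvariant.LocalWeightedDrop` (route `ResolutionOfSingularities/WeightedInvariant`), ENGINE
skeleton v34 (80c4710965b6845c), registered stub `stub_regimePresented`, piece (P3): for res-L1-w43-lead-1's regression test #3 (NOTE 2026-08-27T18:42:21Z,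
kernel-checked in `…TOT2CurveConflictBirthCurveOneExample`, p559128) to bear on the budget laws `hM_succ` / `hM_conf` of
`TameFourTupleDrop.regimePresented_of_pieces`, both labels must be regime labels (`PolyDescent.InPoly` = well-prepared ∧ position ∧ non-empty Newton
set).  This file proves that, in the style of res-type-088's `inPoly_pointExample` (…TOT2CurveConflictBirthPointExample, p545241), for every ground
field.  [OURS · L1 W4.3 · chain w43 · seat res-L1-w43-stub-1 gen 6; def-free; nothing here is a statement of any manuscript; AI-produced, gate-checked,
weaker than expert review.]

* `A = (u₁²(u₂+u₁)³, 0)`: support ⊆ {(2,3),(3,2),(4,1),(5,0)}, vertices among the extreme points `(2,3)`, `(5,0)` (odd coordinates ⇒ not integral for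
  `d = 2`), the middle points are never vertices ⇒ `wellPrepared_curveOneExample`, **`inPoly_curveOneExample`**;
* `A′ = ((u₂+u₁)³, 0)`: support ⊆ {(0,3),(1,2),(2,1),(3,0)} ⇒ `isPosT_curveOneExample_after`, `wellPrepared_curveOneExample_after`,
  **`inPoly_curveOneExample_after`**.
-/

set_option linter.dupNamespace false -- mandated namespace of this single-conjunct summit

noncomputable section

namespace Summit.ResolutionOfSingularities.ResolutionOfSingularities.Theorems

namespace TOT2Curve

open MvPowerSeries PolyDescent MonicDescent WildMonic Literature.AlgebraicGeometry.Resolution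

variable {k : Type} [Field k]

/-! ## The label before the move -/

/-- The coefficients of `u₁²(u₂+u₁)³ = u₁²u₂³ + 3u₁³u₂² + 3u₁⁴u₂ + u₁⁵`. -/
theorem coeff_curveOneExample (e : Fin 2 →₀ ℕ) :
    coeff e (X 0 ^ 2 * (X 1 + X 0) ^ 3 : MvPowerSeries (Fin 2) k) =
      (if e = Finsupp.single 0 2 + Finsupp.single 1 3 then 1 else 0) + 3 * (if e = Finsupp.single 0 3 + Finsupp.single 1 2 then 1 else 0) +
        3 * (if e = Finsupp.single 0 4 + Finsupp.single 1 1 then 1 else 0) + (if e = Finsupp.single 0 5 then 1 else 0) := by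
  have hA : (X 0 ^ 2 * (X 1 + X 0) ^ 3 : MvPowerSeries (Fin 2) k) =
      X 0 ^ 2 * X 1 ^ 3 + C 3 * (X 0 ^ 3 * X 1 ^ 2) + C 3 * (X 0 ^ 4 * X 1 ^ 1) + X 0 ^ 5 := by
    rw [map_ofNat]; ring
  rw [hA, map_add, map_add, map_add, coeff_C_mul, coeff_C_mul, X_pow_eq, X_pow_eq, X_pow_eq, X_pow_eq, X_pow_eq, X_pow_eq, X_pow_eq,
    monomial_mul_monomial, monomial_mul_monomial, monomial_mul_monomial, one_mul, coeff_monomial, coeff_monomial, coeff_monomial, coeff_monomial]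

/-- The support of `u₁²(u₂+u₁)³`. -/
theorem support_curveOneExample {e : Fin 2 →₀ ℕ} (he : coeff e (X 0 ^ 2 * (X 1 + X 0) ^ 3 : MvPowerSeries (Fin 2) k) ≠ 0) :
    e = Finsupp.single 0 2 + Finsupp.single 1 3 ∨ e = Finsupp.single 0 3 + Finsupp.single 1 2 ∨ e = Finsupp.single 0 4 + Finsupp.single 1 1 ∨
      e = Finsupp.single 0 5 := by
  by_contra hne
  push Not at hne
  apply he
  rw [coeff_curveOneExample, if_neg hne.1, if_neg hne.2.1, if_neg hne.2.2.1, if_neg hne.2.2.2]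
  ring

/-- The scaled Newton set of `A` consists of exponents of `A₀`. -/
theorem mem_newtonSet_curveOneExample {P : Fin 2 →₀ ℕ}
    (hP : P ∈ newtonSet (![X 0 ^ 2 * (X 1 + X 0) ^ 3, 0] : Fin 2 → MvPowerSeries (Fin 2) k)) :
    P = Finsupp.single 0 2 + Finsupp.single 1 3 ∨ P = Finsupp.single 0 3 + Finsupp.single 1 2 ∨ P = Finsupp.single 0 4 + Finsupp.single 1 1 ∨
      P = Finsupp.single 0 5 := by
  rw [WildMonic.mem_newtonSet_iff] at hP
  obtain ⟨⟨j, hj⟩, e, he, hPe⟩ := hP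
  rcases j with _ | _ | j
  · change coeff e (X 0 ^ 2 * (X 1 + X 0) ^ 3 : MvPowerSeries (Fin 2) k) ≠ 0 at he
    change P = slotWeight 2 0 • e at hPe
    rw [show slotWeight 2 0 = 1 by decide, one_smul] at hPe
    rw [hPe]
    exact support_curveOneExample he
  · change coeff e (0 : MvPowerSeries (Fin 2) k) ≠ 0 at he
    exact absurd (map_zero _) he
  · omega

/-- The two extreme exponents lie in the Newton set (coefficient `1`). -/
theorem mem_newtonSet_curveOneExample_of_eq {P : Fin 2 →₀ ℕ} (hP : P = Finsupp.single 0 2 + Finsupp.single 1 3 ∨ P = Finsupp.single 0 5) :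
    P ∈ newtonSet (![X 0 ^ 2 * (X 1 + X 0) ^ 3, 0] : Fin 2 → MvPowerSeries (Fin 2) k) := by
  rw [WildMonic.mem_newtonSet_iff]
  refine ⟨0, P, ?_, by rw [show slotWeight 2 ↑(0 : Fin 2) = 1 by decide, one_smul]⟩
  show coeff P (X 0 ^ 2 * (X 1 + X 0) ^ 3 : MvPowerSeries (Fin 2) k) ≠ 0
  have ha : (Finsupp.single (0 : Fin 2) 2 + Finsupp.single 1 3 : Fin 2 →₀ ℕ) ≠ Finsupp.single 0 3 + Finsupp.single 1 2 := fun h => by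
    have := congrArg (fun f : Fin 2 →₀ ℕ => f 1) h; simp at this
  have hb : (Finsupp.single (0 : Fin 2) 2 + Finsupp.single 1 3 : Fin 2 →₀ ℕ) ≠ Finsupp.single 0 4 + Finsupp.single 1 1 := fun h => by
    have := congrArg (fun f : Fin 2 →₀ ℕ => f 1) h; simp at this
  have hc : (Finsupp.single (0 : Fin 2) 2 + Finsupp.single 1 3 : Fin 2 →₀ ℕ) ≠ Finsupp.single 0 5 := fun h => by
    have := congrArg (fun f : Fin 2 →₀ ℕ => f 1) h; simp at this
  have hd : (Finsupp.single (0 : Fin 2) 5 : Fin 2 →₀ ℕ) ≠ Finsupp.single 0 2 + Finsupp.single 1 3 := fun h => by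
    have := congrArg (fun f : Fin 2 →₀ ℕ => f 1) h; simp at this
  have he : (Finsupp.single (0 : Fin 2) 5 : Fin 2 →₀ ℕ) ≠ Finsupp.single 0 3 + Finsupp.single 1 2 := fun h => by
    have := congrArg (fun f : Fin 2 →₀ ℕ => f 1) h; simp at this
  have hf : (Finsupp.single (0 : Fin 2) 5 : Fin 2 →₀ ℕ) ≠ Finsupp.single 0 4 + Finsupp.single 1 1 := fun h => by
    have := congrArg (fun f : Fin 2 →₀ ℕ => f 1) h; simp at this
  rcases hP with rfl | rfl
  · rw [coeff_curveOneExample, if_pos rfl, if_neg ha, if_neg hb, if_neg hc]; norm_num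
  · rw [coeff_curveOneExample, if_neg hd, if_neg he, if_neg hf, if_pos rfl]; norm_num

/-- **`A` IS WELL-PREPARED**: its vertices are among `(2,3)` and `(5,0)` (not integral for `d = 2`); the middle points are never vertices. -/
theorem wellPrepared_curveOneExample : WellPrepared 2 (![X 0 ^ 2 * (X 1 + X 0) ^ 3, 0] : Fin 2 → MvPowerSeries (Fin 2) k) := by
  intro P hV hS
  obtain ⟨hP, w, -, hmin⟩ := hV
  obtain ⟨hint, -⟩ := hS
  have h1 := hmin _ (mem_newtonSet_curveOneExample_of_eq (k := k) (Or.inl rfl))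
  have h2 := hmin _ (mem_newtonSet_curveOneExample_of_eq (k := k) (Or.inr rfl))
  rcases mem_newtonSet_curveOneExample hP with rfl | rfl | rfl | rfl
  · have h := hint 1
    rw [Nat.factorial_two] at h
    simp at h
  · have h1' := h1 (fun h => by have := congrArg (fun f : Fin 2 →₀ ℕ => f 1) h; simp at this)
    have h2' := h2 (fun h => by have := congrArg (fun f : Fin 2 →₀ ℕ => f 1) h; simp at this)
    rw [weight_single_add_single, weight_single_add_single] at h1'
    rw [weight_single_add_single, show (Finsupp.single (0 : Fin 2) 5 : Fin 2 →₀ ℕ) = Finsupp.single 0 5 + Finsupp.single 1 0 by simp,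
      weight_single_add_single] at h2'
    omega
  · have h1' := h1 (fun h => by have := congrArg (fun f : Fin 2 →₀ ℕ => f 1) h; simp at this)
    have h2' := h2 (fun h => by have := congrArg (fun f : Fin 2 →₀ ℕ => f 1) h; simp at this)
    rw [weight_single_add_single, weight_single_add_single] at h1'
    rw [weight_single_add_single, show (Finsupp.single (0 : Fin 2) 5 : Fin 2 →₀ ℕ) = Finsupp.single 0 5 + Finsupp.single 1 0 by simp,
      weight_single_add_single] at h2'
    omega
  · have h := hint 0
    rw [Nat.factorial_two] at h
    simp at h

/-- **`A` IS A REGIME LABEL.** -/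
theorem inPoly_curveOneExample : InPoly 2 (![X 0 ^ 2 * (X 1 + X 0) ^ 3, 0] : Fin 2 → MvPowerSeries (Fin 2) k) :=
  ⟨wellPrepared_curveOneExample, isPosT_curveOneExample, ⟨_, mem_newtonSet_curveOneExample_of_eq (Or.inr rfl)⟩⟩

/-! ## The label after the move -/

/-- The coefficients of `(u₂+u₁)³ = u₂³ + 3u₁u₂² + 3u₁²u₂ + u₁³`. -/
theorem coeff_curveOneExample_after (e : Fin 2 →₀ ℕ) :
    coeff e ((X 1 + X 0) ^ 3 : MvPowerSeries (Fin 2) k) =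
      (if e = Finsupp.single 1 3 then 1 else 0) + 3 * (if e = Finsupp.single 0 1 + Finsupp.single 1 2 then 1 else 0) +
        3 * (if e = Finsupp.single 0 2 + Finsupp.single 1 1 then 1 else 0) + (if e = Finsupp.single 0 3 then 1 else 0) := by
  have hA : ((X 1 + X 0) ^ 3 : MvPowerSeries (Fin 2) k) =
      X 1 ^ 3 + C 3 * (X 0 ^ 1 * X 1 ^ 2) + C 3 * (X 0 ^ 2 * X 1 ^ 1) + X 0 ^ 3 := by
    rw [map_ofNat]; ring
  rw [hA, map_add, map_add, map_add, coeff_C_mul, coeff_C_mul, X_pow_eq, X_pow_eq, X_pow_eq, X_pow_eq, X_pow_eq, X_pow_eq,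
    monomial_mul_monomial, monomial_mul_monomial, one_mul, coeff_monomial, coeff_monomial, coeff_monomial, coeff_monomial]

/-- The support of `(u₂+u₁)³`. -/
theorem support_curveOneExample_after {e : Fin 2 →₀ ℕ} (he : coeff e ((X 1 + X 0) ^ 3 : MvPowerSeries (Fin 2) k) ≠ 0) :
    e = Finsupp.single 1 3 ∨ e = Finsupp.single 0 1 + Finsupp.single 1 2 ∨ e = Finsupp.single 0 2 + Finsupp.single 1 1 ∨ e = Finsupp.single 0 3 := by
  by_contra hne
  push Not at hne
  apply he
  rw [coeff_curveOneExample_after, if_neg hne.1, if_neg hne.2.1, if_neg hne.2.2.1, if_neg hne.2.2.2]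
  ring

/-- The scaled Newton set of `A′` consists of exponents of `A′₀`. -/
theorem mem_newtonSet_curveOneExample_after {P : Fin 2 →₀ ℕ}
    (hP : P ∈ newtonSet (![(X 1 + X 0) ^ 3, 0] : Fin 2 → MvPowerSeries (Fin 2) k)) :
    P = Finsupp.single 1 3 ∨ P = Finsupp.single 0 1 + Finsupp.single 1 2 ∨ P = Finsupp.single 0 2 + Finsupp.single 1 1 ∨ P = Finsupp.single 0 3 := by
  rw [WildMonic.mem_newtonSet_iff] at hP
  obtain ⟨⟨j, hj⟩, e, he, hPe⟩ := hP
  rcases j with _ | _ | j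
  · change coeff e ((X 1 + X 0) ^ 3 : MvPowerSeries (Fin 2) k) ≠ 0 at he
    change P = slotWeight 2 0 • e at hPe
    rw [show slotWeight 2 0 = 1 by decide, one_smul] at hPe
    rw [hPe]
    exact support_curveOneExample_after he
  · change coeff e (0 : MvPowerSeries (Fin 2) k) ≠ 0 at he
    exact absurd (map_zero _) he
  · omega

/-- The two extreme exponents of `A′₀` lie in the Newton set. -/
theorem mem_newtonSet_curveOneExample_after_of_eq {P : Fin 2 →₀ ℕ} (hP : P = Finsupp.single 1 3 ∨ P = Finsupp.single 0 3) :
    P ∈ newtonSet (![(X 1 + X 0) ^ 3, 0] : Fin 2 → MvPowerSeries (Fin 2) k) := by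
  rw [WildMonic.mem_newtonSet_iff]
  refine ⟨0, P, ?_, by rw [show slotWeight 2 ↑(0 : Fin 2) = 1 by decide, one_smul]⟩
  show coeff P ((X 1 + X 0) ^ 3 : MvPowerSeries (Fin 2) k) ≠ 0
  have ha : (Finsupp.single (1 : Fin 2) 3 : Fin 2 →₀ ℕ) ≠ Finsupp.single 0 1 + Finsupp.single 1 2 := fun h => by
    have := congrArg (fun f : Fin 2 →₀ ℕ => f 0) h; simp at this
  have hb : (Finsupp.single (1 : Fin 2) 3 : Fin 2 →₀ ℕ) ≠ Finsupp.single 0 2 + Finsupp.single 1 1 := fun h => by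
    have := congrArg (fun f : Fin 2 →₀ ℕ => f 0) h; simp at this
  have hc : (Finsupp.single (1 : Fin 2) 3 : Fin 2 →₀ ℕ) ≠ Finsupp.single 0 3 := fun h => by
    have := congrArg (fun f : Fin 2 →₀ ℕ => f 0) h; simp at this
  have hd : (Finsupp.single (0 : Fin 2) 3 : Fin 2 →₀ ℕ) ≠ Finsupp.single 1 3 := fun h => by
    have := congrArg (fun f : Fin 2 →₀ ℕ => f 0) h; simp at this
  have he : (Finsupp.single (0 : Fin 2) 3 : Fin 2 →₀ ℕ) ≠ Finsupp.single 0 1 + Finsupp.single 1 2 := fun h => by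
    have := congrArg (fun f : Fin 2 →₀ ℕ => f 1) h; simp at this
  have hf : (Finsupp.single (0 : Fin 2) 3 : Fin 2 →₀ ℕ) ≠ Finsupp.single 0 2 + Finsupp.single 1 1 := fun h => by
    have := congrArg (fun f : Fin 2 →₀ ℕ => f 1) h; simp at this
  rcases hP with rfl | rfl
  · rw [coeff_curveOneExample_after, if_pos rfl, if_neg ha, if_neg hb, if_neg hc]; norm_num
  · rw [coeff_curveOneExample_after, if_neg hd, if_neg he, if_neg hf, if_pos rfl]; norm_num

/-- `A′ = ((u₂+u₁)³, 0)` is a position: `ord A′₀ = 3 > 2`, `A′₁ = 0`. -/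
theorem isPosT_curveOneExample_after : IsPosT 2 (![(X 1 + X 0) ^ 3, 0] : Fin 2 → MvPowerSeries (Fin 2) k) := by
  intro j
  fin_cases j
  · show ((2 - 0 : ℕ) : ℕ∞) < ((X 1 + X 0) ^ 3 : MvPowerSeries (Fin 2) k).order
    have hw : (1 : ℕ∞) ≤ (X 1 + X 0 : MvPowerSeries (Fin 2) k).order := by
      rw [one_le_order_iff_constCoeff_eq_zero, map_add, constantCoeff_X, constantCoeff_X, add_zero]
    have h3 : (3 : ℕ∞) ≤ ((X 1 + X 0) ^ 3 : MvPowerSeries (Fin 2) k).order := by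
      rw [show ((X 1 + X 0) ^ 3 : MvPowerSeries (Fin 2) k) = (X 1 + X 0) * ((X 1 + X 0) * (X 1 + X 0)) by ring]
      refine le_trans ?_ le_order_mul
      refine le_trans ?_ (add_le_add hw (le_trans (add_le_add hw hw) le_order_mul))
      norm_num
    exact lt_of_lt_of_le (by norm_num) h3
  · show ((2 - 1 : ℕ) : ℕ∞) < (0 : MvPowerSeries (Fin 2) k).order
    rw [order_zero]; exact WithTop.coe_lt_top _

/-- **`A′` IS WELL-PREPARED**: its vertices are among `(0,3)` and `(3,0)` (not integral for `d = 2`); the middle points are never vertices. -/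
theorem wellPrepared_curveOneExample_after : WellPrepared 2 (![(X 1 + X 0) ^ 3, 0] : Fin 2 → MvPowerSeries (Fin 2) k) := by
  intro P hV hS
  obtain ⟨hP, w, -, hmin⟩ := hV
  obtain ⟨hint, -⟩ := hS
  have h1 := hmin _ (mem_newtonSet_curveOneExample_after_of_eq (k := k) (Or.inl rfl))
  have h2 := hmin _ (mem_newtonSet_curveOneExample_after_of_eq (k := k) (Or.inr rfl))
  rcases mem_newtonSet_curveOneExample_after hP with rfl | rfl | rfl | rfl
  · have h := hint 1
    rw [Nat.factorial_two] at h
    simp at h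
  · have h1' := h1 (fun h => by have := congrArg (fun f : Fin 2 →₀ ℕ => f 0) h; simp at this)
    have h2' := h2 (fun h => by have := congrArg (fun f : Fin 2 →₀ ℕ => f 1) h; simp at this)
    rw [weight_single_add_single, show (Finsupp.single (1 : Fin 2) 3 : Fin 2 →₀ ℕ) = Finsupp.single 0 0 + Finsupp.single 1 3 by simp,
      weight_single_add_single] at h1'
    rw [weight_single_add_single, show (Finsupp.single (0 : Fin 2) 3 : Fin 2 →₀ ℕ) = Finsupp.single 0 3 + Finsupp.single 1 0 by simp,
      weight_single_add_single] at h2'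
    omega
  · have h1' := h1 (fun h => by have := congrArg (fun f : Fin 2 →₀ ℕ => f 0) h; simp at this)
    have h2' := h2 (fun h => by have := congrArg (fun f : Fin 2 →₀ ℕ => f 1) h; simp at this)
    rw [weight_single_add_single, show (Finsupp.single (1 : Fin 2) 3 : Fin 2 →₀ ℕ) = Finsupp.single 0 0 + Finsupp.single 1 3 by simp,
      weight_single_add_single] at h1'
    rw [weight_single_add_single, show (Finsupp.single (0 : Fin 2) 3 : Fin 2 →₀ ℕ) = Finsupp.single 0 3 + Finsupp.single 1 0 by simp,
      weight_single_add_single] at h2'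
    omega
  · have h := hint 0
    rw [Nat.factorial_two] at h
    simp at h

/-- **`A′` IS A REGIME LABEL.** -/
theorem inPoly_curveOneExample_after : InPoly 2 (![(X 1 + X 0) ^ 3, 0] : Fin 2 → MvPowerSeries (Fin 2) k) :=
  ⟨wellPrepared_curveOneExample_after, isPosT_curveOneExample_after, ⟨_, mem_newtonSet_curveOneExample_after_of_eq (Or.inr rfl)⟩⟩

end TOT2Curve

end Summit.ResolutionOfSingularities.ResolutionOfSingularities.Theorems

end
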